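import Literature.AnabelianGeometry.EtaleTheta.SettingModel2Curve
import Mathlib.Topology.Instances.ZMod
import HarnessLib

/-!
# A FINER model of the [EtTh] §1 root, part B: the profinite level maps and the theta-quotient kernels

Mochizuki, *The étale theta function …*, Publ. RIMS **45** (2009) [EtTh], §1, PRIMS PDF pp. 12–14
[cite: MochizukiEtTh2009, §1 p.12]: "`Δ^Θ_X := Δ_X/[Δ_X,[Δ_X,Δ_X]]`", "`Δ^tp_Y/Δ^tp_{Y_N} ≅ ℤ/Nℤ(1)`",
"`1 → Δ_Θ ⊗ ℤ/Nℤ → Gal(Z_N/Y_N) → …`". Layer L2 of the abc-iut cell, seat abc-iut-L2-t1 (root owner);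
vacuity lane, sequel of `SettingModel2Curve.lean` (`curve₂ p`: `Π^tp := (F̂₂ ×_Ẑ ℤ) × G_{ℚ_p}`).

Contents: (1) the discrete topology on the Heisenberg groups `Heis R` (instances on the NEW carrier only)
and the continuous LEVEL MAPS `modN : Ẑ → ℤ/N`, `hHat N : F̂₂ → Heis (ℤ/N)` (profinite universal property),
their values on `η(F₂)`, the compatibility `hHat M = (mod M) ∘ hHat N` for `M ∣ N`, the vanishing of the
`x`-coordinate on `Ker ê`, and the killing of `[[F̂₂,F̂₂],F̂₂]⁻`; (2) the pulled-back closures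
`KEll₂ ⊇ KTheta₂` of `[Δ_X,Δ_X]`, `[[Δ_X,Δ_X],Δ_X]` under `toHat` (normal), the commutator-continuity lemma
`commutatorElement_mem_KTheta₂`, and `hHat_eq_one_and_snd_eq_one_of_mem_KTheta₂` (an element of `KTheta₂`
has trivial `Γ_{arith}`-component and dies under every level map). Consistency evidence only; nothing of
[EtTh] asserted; no side taken on [IUTchIII] Cor. 3.12.
-/

noncomputable section

namespace Literature.AnabelianGeometry.EtaleTheta.SettingModel

open Literature.AnabelianGeometry.SemiGraphs
open CategoryTheory Function
open scoped commutatorElement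

/-! ### Discrete topology on the Heisenberg groups; level maps -/

/-- [folklore] -/ instance Heis.instTopologicalSpace (R : Type*) : TopologicalSpace (Heis R) := ⊥
/-- [folklore] -/ instance Heis.instDiscreteTopology (R : Type*) : DiscreteTopology (Heis R) := ⟨rfl⟩

/-- `Ẑ → ℤ/N`, the continuous extension of reduction mod `N`. [cite: MochizukiEtTh2009, §1 p.13] -/
def modN (N : ℕ+) : ZH →ₜ* Multiplicative (ZMod N) :=
  (ProfiniteGrp.ProfiniteCompletion.lift (P := ProfiniteGrp.of (Multiplicative (ZMod N)))
    (GrpCat.ofHom (AddMonoidHom.toMultiplicative (Int.castAddHom (ZMod N))))).hom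

/-- `modN N (ι k) = k mod N`. [cite: MochizukiEtTh2009, §1 p.13] -/
theorem modN_iotaZ (N : ℕ+) (k : Multiplicative ℤ) :
    modN N (iotaZ k) = Multiplicative.ofAdd ((Multiplicative.toAdd k : ℤ) : ZMod N) :=
  lift_hom_toCompletion (ProfiniteGrp.of (Multiplicative (ZMod N)))
    (AddMonoidHom.toMultiplicative (Int.castAddHom (ZMod N))) k

/-- **`ĥ_N : F̂₂ → Heis (ℤ/N)`**, the continuous extension of `F₂ ↠ Heis ℤ → Heis (ℤ/N)` (the finite class-2
quotients of `Δ^Θ_X`, p. 12). [cite: MochizukiEtTh2009, §1 p.12] -/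
def hHat (N : ℕ+) : F₂hatT →ₜ* Heis (ZMod N) :=
  (ProfiniteGrp.ProfiniteCompletion.lift (P := ProfiniteGrp.of (Heis (ZMod N)))
    (GrpCat.ofHom ((Heis.map (Int.castRingHom (ZMod N))).comp heisHom))).hom

/-- `ĥ_N (η g) = heisHom g mod N`. [cite: MochizukiEtTh2009, §1 p.12] -/
theorem hHat_eta (N : ℕ+) (g : F₂) :
    hHat N (eta g) = Heis.map (Int.castRingHom (ZMod N)) (heisHom g) :=
  lift_hom_toCompletion (ProfiniteGrp.of (Heis (ZMod N)))
    ((Heis.map (Int.castRingHom (ZMod N))).comp heisHom) g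

/-- **Compatibility of the level maps**: for `M ∣ N`, reducing `ĥ_N` mod `M` gives `ĥ_M` (two continuous
homomorphisms agreeing on the dense `η(F₂)`). [cite: MochizukiEtTh2009, §1 p.18] -/
theorem map_hHat_of_dvd {M N : ℕ+} (h : (M : ℕ) ∣ N) (x : F₂hatT) :
    Heis.map (ZMod.castHom h (ZMod M)) (hHat N x) = hHat M x := by
  have key : (fun x => Heis.map (ZMod.castHom h (ZMod M)) (hHat N x)) = fun x => hHat M x := by
    refine denseRange_eta.equalizer ?_ (hHat M).continuous ?_
    · exact (continuous_of_discreteTopology (f := Heis.map (ZMod.castHom h (ZMod M)))).comp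
        (hHat N).continuous
    · funext g
      simp only [Function.comp_apply, hHat_eta, Heis.map_apply, Heis.ext_iff]
      refine ⟨?_, ?_, ?_⟩ <;> simp
  exact congrFun key x

/-- The `x`-coordinate of `ĥ_N` is the reduction mod `N` of `ê`. [cite: MochizukiEtTh2009, §1 p.12] -/
theorem hHat_x_eq_modN_eHat (N : ℕ+) (x : F₂hatT) :
    Multiplicative.ofAdd (hHat N x).x = modN N (eHat x) := by
  have key : (fun x => Multiplicative.ofAdd (hHat N x).x) = fun x => modN N (eHat x) := by
    refine denseRange_eta.equalizer ?_ ((modN N).continuous.comp eHat.continuous) ?_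
    · exact (continuous_of_discreteTopology (f := fun h : Heis (ZMod N) => Multiplicative.ofAdd h.x)).comp
        (hHat N).continuous
    · funext g
      simp only [Function.comp_apply, hHat_eta, eHat_eta, modN_iotaZ, expA_apply, Heis.map_apply,
        Int.coe_castRingHom, toAdd_ofAdd]
  exact congrFun key x

/-- On `Ker ê` the `x`-coordinate of every level map vanishes. [cite: MochizukiEtTh2009, §1 p.12] -/
theorem hHat_x_eq_zero_of_eHat_eq_one (N : ℕ+) {x : F₂hatT} (hx : eHat x = 1) : (hHat N x).x = 0 := by
  have h := hHat_x_eq_modN_eHat N x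
  rw [hx, map_one] at h
  exact ofAdd_eq_one.mp h

/-- Every level map kills `[[F̂₂,F̂₂],F̂₂]⁻` (class `≤ 2`, closed kernel). [cite: MochizukiEtTh2009, §1 p.12] -/
theorem hHat_eq_one_of_mem_closure (N : ℕ+) {x : F₂hatT}
    (hx : x ∈ (⁅⁅(⊤ : Subgroup F₂hatT), (⊤ : Subgroup F₂hatT)⁆, (⊤ : Subgroup F₂hatT)⁆).topologicalClosure) :
    hHat N x = 1 := by
  have hker : (⁅⁅(⊤ : Subgroup F₂hatT), (⊤ : Subgroup F₂hatT)⁆, (⊤ : Subgroup F₂hatT)⁆).topologicalClosure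
      ≤ (hHat N).toMonoidHom.ker := by
    refine Subgroup.topologicalClosure_minimal _ (Heis.commutator_commutator_le_ker _) ?_
    have : SetLike.coe (hHat N).toMonoidHom.ker = hHat N ⁻¹' {1} := by
      ext y; simp [MonoidHom.mem_ker]
    rw [this]
    exact (isClosed_discrete _).preimage (hHat N).continuous
  exact hker hx

variable (p : ℕ) [Fact p.Prime]

/-! ### The theta-quotient kernels over `curve₂` -/

/-- `KEll₂ := toHat⁻¹([Δ_X,Δ_X]⁻)`. [cite: MochizukiEtTh2009, §1 p.12] -/
def KEll₂ : Subgroup (PiTp₂ p) :=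
  (⁅(curve₂ p).DeltaHat, (curve₂ p).DeltaHat⁆.topologicalClosure).comap (curve₂ p).toHat.toMonoidHom

/-- `KTheta₂ := toHat⁻¹([[Δ_X,Δ_X],Δ_X]⁻)`. [cite: MochizukiEtTh2009, §1 p.12] -/
def KTheta₂ : Subgroup (PiTp₂ p) :=
  (⁅⁅(curve₂ p).DeltaHat, (curve₂ p).DeltaHat⁆, (curve₂ p).DeltaHat⁆.topologicalClosure).comap
    (curve₂ p).toHat.toMonoidHom

/-- [folklore] -/
instance KEll₂_normal : (KEll₂ p).Normal := by
  haveI := deltaHat₂_normal p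
  unfold KEll₂
  haveI : (⁅(curve₂ p).DeltaHat, (curve₂ p).DeltaHat⁆.topologicalClosure).Normal :=
    Subgroup.is_normal_topologicalClosure _
  exact Subgroup.Normal.comap inferInstance _

/-- [folklore] -/
instance KTheta₂_normal : (KTheta₂ p).Normal := by
  haveI := deltaHat₂_normal p
  unfold KTheta₂
  haveI : (⁅⁅(curve₂ p).DeltaHat, (curve₂ p).DeltaHat⁆, (curve₂ p).DeltaHat⁆.topologicalClosure).Normal :=
    Subgroup.is_normal_topologicalClosure _
  exact Subgroup.Normal.comap inferInstance _

/-- `F̂₂ × 1` is closed in `Π_X`. [folklore] -/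
private theorem isClosed_top_prod_bot :
    IsClosed (((⊤ : Subgroup F₂hatT).prod (⊥ : Subgroup (GamHatT p)) : Subgroup (PiHt p)) : Set (PiHt p)) := by
  have : (((⊤ : Subgroup F₂hatT).prod (⊥ : Subgroup (GamHatT p)) : Subgroup (PiHt p)) : Set (PiHt p)) =
      Set.univ ×ˢ {1} := by
    ext x; simp [Subgroup.mem_prod, Subgroup.mem_bot]
  rw [this]
  exact isClosed_univ.prod isClosed_singleton

/-- `[Δ_X,Δ_X]⁻ ≤ Δ_X`. [cite: MochizukiEtTh2009, §1 p.12] -/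
theorem commutatorClosure_le_deltaHat₂ :
    (⁅(curve₂ p).DeltaHat, (curve₂ p).DeltaHat⁆).topologicalClosure ≤ (curve₂ p).DeltaHat := by
  haveI := deltaHat₂_normal p
  refine Subgroup.topologicalClosure_minimal _ (Subgroup.commutator_le_left _ _) ?_
  rw [deltaHat₂_eq]
  exact isClosed_top_prod_bot p

/-- `KTheta₂ ≤ KEll₂`. [cite: MochizukiEtTh2009, §1 p.12] -/
theorem KTheta₂_le_KEll₂ : KTheta₂ p ≤ KEll₂ p := by
  haveI := deltaHat₂_normal p
  refine Subgroup.comap_mono (Subgroup.topologicalClosure_mono ?_)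
  exact Subgroup.commutator_mono (Subgroup.commutator_le_left _ _) le_rfl

/-- `⁅a, b⁆ ∈ closure ⁅A, B⁆` for `a ∈ closure A`, `b ∈ B`. [folklore] -/
private theorem commutatorElement_mem_closure₂ {G : Type*} [Group G] [TopologicalSpace G]
    [IsTopologicalGroup G] (A B : Subgroup G) {a b : G} (ha : a ∈ A.topologicalClosure) (hb : b ∈ B) :
    ⁅a, b⁆ ∈ (⁅A, B⁆).topologicalClosure := by
  have hcont : Continuous fun x : G => ⁅x, b⁆ := by
    simp only [commutatorElement_def]
    fun_prop
  have hsub : (A : Set G) ⊆ (fun x : G => ⁅x, b⁆) ⁻¹' ((⁅A, B⁆).topologicalClosure : Set G) :=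
    fun x hx => Subgroup.le_topologicalClosure _ (Subgroup.commutator_mem_commutator hx hb)
  have hcl := closure_minimal hsub ((Subgroup.isClosed_topologicalClosure _).preimage hcont)
  have ha' : a ∈ (A.topologicalClosure : Set G) := ha
  rw [Subgroup.topologicalClosure_coe] at ha'
  exact hcl ha'

/-- For `a ∈ KEll₂` and `b` with `toHat b ∈ Δ_X`: `⁅a, b⁆ ∈ KTheta₂`. [cite: MochizukiEtTh2009, §1 p.12] -/
theorem commutatorElement_mem_KTheta₂ {a b : PiTp₂ p} (ha : a ∈ KEll₂ p)
    (hb : (curve₂ p).toHat b ∈ (curve₂ p).DeltaHat) : ⁅a, b⁆ ∈ KTheta₂ p := by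
  have ha' : (curve₂ p).toHat.toMonoidHom a ∈
      (⁅(curve₂ p).DeltaHat, (curve₂ p).DeltaHat⁆).topologicalClosure := ha
  have hb' : (curve₂ p).toHat.toMonoidHom b ∈ (curve₂ p).DeltaHat := hb
  have key := commutatorElement_mem_closure₂ _ _ ha' hb'
  rw [← map_commutatorElement] at key
  exact key

/-- `toHat b ∈ Δ_X` for `b ∈ KEll₂`. [cite: MochizukiEtTh2009, §1 p.12] -/
theorem toHat_mem_deltaHat_of_mem_KEll₂ {b : PiTp₂ p} (hb : b ∈ KEll₂ p) :
    (curve₂ p).toHat b ∈ (curve₂ p).DeltaHat :=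
  commutatorClosure_le_deltaHat₂ p hb

/-- `toHat b ∈ Δ_X` for `b ∈ Δ^tp_X`. [cite: MochizukiEtTh2009, §1 p.12] -/
theorem toHat_mem_deltaHat_of_mem_deltaTemp₂ {b : PiTp₂ p} (hb : b ∈ (curve₂ p).DeltaTemp) :
    (curve₂ p).toHat b ∈ (curve₂ p).DeltaHat :=
  Subgroup.le_topologicalClosure _ ⟨b, hb, rfl⟩

/-- A continuous homomorphism maps the closure of a subgroup into the closure of its image. [folklore] -/
private theorem map_mem_topologicalClosure_map₂ {G G' : Type*} [Group G] [TopologicalSpace G]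
    [IsTopologicalGroup G] [Group G'] [TopologicalSpace G'] [IsTopologicalGroup G'] (f : G →* G')
    (hf : Continuous f) {H : Subgroup G} {x : G} (hx : x ∈ H.topologicalClosure) :
    f x ∈ (H.map f).topologicalClosure := by
  have hx' : x ∈ closure (H : Set G) := by
    have : x ∈ (H.topologicalClosure : Set G) := hx
    rwa [Subgroup.topologicalClosure_coe] at this
  have h2 := image_closure_subset_closure_image hf ⟨x, hx', rfl⟩
  show f x ∈ ((H.map f).topologicalClosure : Set G')
  rw [Subgroup.topologicalClosure_coe, Subgroup.coe_map]
  exact h2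

/-- **An element of `KTheta₂` dies under every level map and has trivial arithmetic component.**
[cite: MochizukiEtTh2009, §1 p.14] -/
theorem hHat_eq_one_and_snd_eq_one_of_mem_KTheta₂ {g : PiTp₂ p} (hg : g ∈ KTheta₂ p) (N : ℕ+) :
    hHat N (g.1 : F₂hatT × Multiplicative ℤ).1 = 1 ∧ g.2 = 1 := by
  haveI := deltaHat₂_normal p
  have hmem : (curve₂ p).toHat g ∈
      (⁅⁅(curve₂ p).DeltaHat, (curve₂ p).DeltaHat⁆, (curve₂ p).DeltaHat⁆).topologicalClosure := hg
  constructor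
  · have hle : (⁅⁅(curve₂ p).DeltaHat, (curve₂ p).DeltaHat⁆, (curve₂ p).DeltaHat⁆ : Subgroup (PiHt p)) ≤
        ⁅⁅(⊤ : Subgroup (PiHt p)), (⊤ : Subgroup (PiHt p))⁆, (⊤ : Subgroup (PiHt p))⁆ :=
      Subgroup.commutator_mono (Subgroup.commutator_mono le_top le_top) le_top
    have h1 := Subgroup.topologicalClosure_mono hle hmem
    have h2 := map_mem_topologicalClosure_map₂ (MonoidHom.fst F₂hatT (GamHatT p)) continuous_fst h1
    have hsurj : Surjective (MonoidHom.fst F₂hatT (GamHatT p)) := fun x => ⟨(x, 1), rfl⟩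
    rw [Subgroup.map_commutator, Subgroup.map_commutator, Subgroup.map_top_of_surjective _ hsurj] at h2
    exact hHat_eq_one_of_mem_closure N h2
  · have h1 := snd_eq_one_of_mem_deltaHat₂ p
      ((Subgroup.topologicalClosure_minimal _
        (Subgroup.commutator_le_right _ (curve₂ p).DeltaHat)
        (by rw [deltaHat₂_eq]; exact isClosed_top_prod_bot p)) hmem)
    exact etaGam_injective p (by rw [map_one]; exact h1)

end Literature.AnabelianGeometry.EtaleTheta.SettingModel

end
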